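import Summits.CriticalPhenomena.PercolationContinuityZ3.Theses.PercNearOneGluing
import Summits.CriticalPhenomena.PercolationContinuityZ3.Theorems.PercNearOneGluingNoHeavyLowerTailOneCutFourBlobs
import HarnessLib

/-!
# `NoHeavyLowerTail` (stmt-CriticalPhenomena-4575) — the two-blob template: the one-cut bound is an identity

Support file for the crux `Summit.CriticalPhenomena.PercolationContinuityZ3.Theses.PercNearOneGluing.NoHeavyLowerTail`,
line `one-cut-symmetrisation` (route task nh7-symmetrise): the TERMINAL CASE of the compression scheme of
`…OneCutSymmMoves.lean`.  No definitions, no named facts, no sorries.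

Setting: `μ = prodBernoulli w` on `Fin n`, relays `A`, observer `o`, `N(ω) = |{a ∈ A : o ↔ a}|`,
`EN = Σ_{a∈A} μ(o ↔ a)`, ratio `ρ`, lower-tail event `B_ρ = {1 ≤ N ∧ N < ρ·EN}`.  A TWO-BLOB STRUCTURE is a
labelling `cls : Fin n → Fin 2` such that two points of `insert o A` with the same label are joined almost
surely; `m₀ = |{a ∈ A : cls a = cls o}|` is the relay mass of the observer's blob.  With `x ∈ A` in the
observer's blob and `y ∈ A` in the other blob, this file PROVES (ttrl's "two-blob identity", NARROW.md
2026-08-17, there checked symbolically):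

* `twoBlobs_pairCut_le` — every pairwise cut among relays is `≤ μ(x ↮ y)`: the worst pair cut IS `μ(x ↮ y)`;
* `lowerTail_twoBlobs_eq_cut` — if `m₀ < ρ·EN` and `ρ ≤ 1` then `μ B_ρ = μ(x ↮ y)` EXACTLY;
* `lowerTail_twoBlobs_eq_zero` — if `ρ·EN ≤ m₀` then `μ B_ρ = 0`;
* `oneCut_twoBlobs_sharp` — hence `μ B_ρ ≤ μ(x ↮ y)`, with equality in the threshold regime: the one-cut
  bound (`Theorems.noHeavyLowerTail_of_oneCut`) holds with constant exactly `1` and is ATTAINED on every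
  two-blob template — the extremal family of the engine census (kit j028329) and the target of the
  compression moves.

(The inequality alone also follows from `Theorems.oneCut_of_threeBlobs` with an unused third label; the
point here is the identity.)
-/

noncomputable section

namespace Summit.CriticalPhenomena.PercolationContinuityZ3.Theorems

open MeasureTheory Set Literature.Probability.LatticeModels Literature.Probability.Percolation
open scoped Classical BigOperators

namespace OneCutSymm

variable {n : ℕ}

/-- Two events that agree on a set of full measure have the same mass. [folklore] -/
theorem measureReal_eq_of_inter_eq {Ω : Type*} [MeasurableSpace Ω] (μ : Measure Ω) [IsFiniteMeasure μ]
    {S T G : Set Ω} (hG : μ.real Gᶜ = 0) (h : S ∩ G = T ∩ G) : μ.real S = μ.real T := by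
  have key : ∀ {S T : Set Ω}, S ∩ G = T ∩ G → μ.real S ≤ μ.real T := by
    intro S T hST
    calc μ.real S ≤ μ.real (S ∩ G ∪ Gᶜ) := measureReal_mono fun ω hω => by
            by_cases hωG : ω ∈ G
            · exact Or.inl ⟨hω, hωG⟩
            · exact Or.inr hωG
      _ ≤ μ.real (S ∩ G) + μ.real Gᶜ := measureReal_union_le _ _
      _ = μ.real (T ∩ G) := by rw [hG, add_zero, hST]
      _ ≤ μ.real T := measureReal_mono Set.inter_subset_left
  exact le_antisymm (key h) (key h.symm)

/-- In `Fin 2`, two labels different from a third coincide. [folklore] -/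
theorem fin2_eq_of_ne_of_ne {i j k : Fin 2} (hi : i ≠ k) (hj : j ≠ k) : i = j := by
  revert i j k; decide

/-- **The worst pair cut of a two-blob structure.**  With `x ∈ A` in the observer's blob and `y ∈ A`
in the other blob, every pairwise cut among relays is at most `μ(x ↮ y)` (pairs inside a blob are null,
cross pairs coincide with `{x ↮ y}` almost surely). [folklore] -/
theorem twoBlobs_pairCut_le (w : Sym2 (Fin n) → unitInterval) (A : Finset (Fin n)) (o : Fin n)
    (cls : Fin n → Fin 2)
    (hcls : ∀ u ∈ insert o A, ∀ v ∈ insert o A, cls u = cls v →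
      (prodBernoulli w).real (openConn u v)ᶜ = 0)
    {x y : Fin n} (hx : x ∈ A) (hcx : cls x = cls o) (hy : y ∈ A) (hcy : cls y ≠ cls o) :
    ∀ a ∈ A, ∀ a' ∈ A, (prodBernoulli w).real (openConn a a')ᶜ ≤ (prodBernoulli w).real (openConn x y)ᶜ := by
  classical
  set μ := prodBernoulli w with hμ
  set G := {ω : BondConfig (Fin n) | ∀ u ∈ insert o A, ∀ v ∈ insert o A,
      cls u = cls v → (openGraph ω).Reachable u v} with hG
  have hG0 : μ.real Gᶜ = 0 := blobs_goodSet_compl_null w A o cls hcls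
  intro a ha a' ha'
  by_cases haa : cls a = cls a'
  · rw [hcls a (Finset.mem_insert_of_mem ha) a' (Finset.mem_insert_of_mem ha') haa]
    exact measureReal_nonneg
  -- a cross pair: on the good set `{a ↮ a'} ⊆ {x ↮ y}`
  have hsub : (openConn a a')ᶜ ⊆ (openConn x y)ᶜ ∪ Gᶜ := by
    intro ω hω
    by_cases hωG : ω ∈ G
    · refine Or.inl fun hxy => hω ?_
      have hxA : x ∈ insert o A := Finset.mem_insert_of_mem hx
      have hyA : y ∈ insert o A := Finset.mem_insert_of_mem hy
      have hxy' : (openGraph ω).Reachable x y := hxy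
      -- each of `a`, `a'` is joined to `x` or to `y` according to its label
      have join : ∀ c ∈ A, (openGraph ω).Reachable c x := by
        intro c hc
        by_cases hcc : cls c = cls o
        · exact hωG c (Finset.mem_insert_of_mem hc) x hxA (hcc.trans hcx.symm)
        · exact (hωG c (Finset.mem_insert_of_mem hc) y hyA (fin2_eq_of_ne_of_ne hcc hcy)).trans
            hxy'.symm
      exact (join a ha).trans (join a' ha').symm
    · exact Or.inr hωG
  calc μ.real (openConn a a')ᶜ ≤ μ.real ((openConn x y)ᶜ ∪ Gᶜ) := measureReal_mono hsub
    _ ≤ μ.real (openConn x y)ᶜ + μ.real Gᶜ := measureReal_union_le _ _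
    _ = μ.real (openConn x y)ᶜ := by rw [hG0, add_zero]

/-- **Two-blob identity, threshold regime.**  If the observer's blob carries a relay `x`, the other blob a
relay `y`, `ρ ≤ 1` and `m₀ < ρ·EN`, then `μ{1 ≤ N ∧ N < ρ·EN} = μ(x ↮ y)` exactly: on the good set
`N = m₀ + (|A| − m₀)·1{x ↔ y}`, and `|A| ≥ EN ≥ ρ·EN`. [folklore] -/
theorem lowerTail_twoBlobs_eq_cut (w : Sym2 (Fin n) → unitInterval) (A : Finset (Fin n)) (o : Fin n)
    (cls : Fin n → Fin 2)
    (hcls : ∀ u ∈ insert o A, ∀ v ∈ insert o A, cls u = cls v →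
      (prodBernoulli w).real (openConn u v)ᶜ = 0)
    {x y : Fin n} (hx : x ∈ A) (hcx : cls x = cls o) (hy : y ∈ A) (hcy : cls y ≠ cls o)
    (ρ : ℝ) (hρ1 : ρ ≤ 1)
    (hthr : ((A.filter fun a => cls a = cls o).card : ℝ) <
      ρ * ∑ a ∈ A, (prodBernoulli w).real (openConn o a)) :
    (prodBernoulli w).real {ω : BondConfig (Fin n) |
        1 ≤ (A.filter fun a => ω ∈ openConn o a).card ∧
        ((A.filter fun a => ω ∈ openConn o a).card : ℝ) <
          ρ * ∑ a ∈ A, (prodBernoulli w).real (openConn o a)} =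
    (prodBernoulli w).real (openConn x y)ᶜ := by
  classical
  set μ := prodBernoulli w with hμ
  set EN := ∑ a ∈ A, μ.real (openConn o a) with hEN
  set G := {ω : BondConfig (Fin n) | ∀ u ∈ insert o A, ∀ v ∈ insert o A,
      cls u = cls v → (openGraph ω).Reachable u v} with hG
  have hG0 : μ.real Gᶜ = 0 := blobs_goodSet_compl_null w A o cls hcls
  have hENle : EN ≤ (A.card : ℝ) := expectedCount_le_card w A o
  have hEN0 : 0 ≤ EN := Finset.sum_nonneg fun a _ => measureReal_nonneg
  refine measureReal_eq_of_inter_eq μ hG0 (Set.ext fun ω => ?_)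
  simp only [Set.mem_inter_iff, Set.mem_setOf_eq, Set.mem_compl_iff]
  constructor
  · rintro ⟨⟨h1, hlt⟩, hωG⟩
    refine ⟨fun hxy => ?_, hωG⟩
    -- if `x ↔ y` then every relay is reached and `N = |A| ≥ ρ EN`
    have hall : (A.filter fun a => ω ∈ openConn o a) = A := by
      refine Finset.filter_true_of_mem fun a ha => ?_
      have hox : (openGraph ω).Reachable o x :=
        hωG o (Finset.mem_insert_self _ _) x (Finset.mem_insert_of_mem hx) hcx.symm
      by_cases hca : cls a = cls o
      · exact hωG o (Finset.mem_insert_self _ _) a (Finset.mem_insert_of_mem ha) hca.symm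
      · exact (hox.trans (show (openGraph ω).Reachable x y from hxy)).trans
          (hωG y (Finset.mem_insert_of_mem hy) a (Finset.mem_insert_of_mem ha)
            (fin2_eq_of_ne_of_ne hcy hca))
    rw [hall] at hlt
    have hcard0 : (0 : ℝ) ≤ (A.card : ℝ) := Nat.cast_nonneg _
    nlinarith
  · rintro ⟨hxy, hωG⟩
    refine ⟨⟨?_, ?_⟩, hωG⟩
    · -- `x` is reached
      refine Finset.card_pos.2 ⟨x, Finset.mem_filter.2 ⟨hx, ?_⟩⟩
      exact hωG o (Finset.mem_insert_self _ _) x (Finset.mem_insert_of_mem hx) hcx.symm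
    · -- only the observer's blob is reached
      have hsub : (A.filter fun a => ω ∈ openConn o a) ⊆ (A.filter fun a => cls a = cls o) := by
        intro a ha
        obtain ⟨haA, hoa⟩ := Finset.mem_filter.1 ha
        refine Finset.mem_filter.2 ⟨haA, ?_⟩
        by_contra hca
        apply hxy
        have hox : (openGraph ω).Reachable o x :=
          hωG o (Finset.mem_insert_self _ _) x (Finset.mem_insert_of_mem hx) hcx.symm
        have hay : (openGraph ω).Reachable a y :=
          hωG a (Finset.mem_insert_of_mem haA) y (Finset.mem_insert_of_mem hy)
            (fin2_eq_of_ne_of_ne hca hcy)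
        exact (hox.symm.trans (show (openGraph ω).Reachable o a from hoa)).trans hay
      have hle : ((A.filter fun a => ω ∈ openConn o a).card : ℝ) ≤
          ((A.filter fun a => cls a = cls o).card : ℝ) := by
        exact_mod_cast Finset.card_le_card hsub
      exact lt_of_le_of_lt hle hthr

/-- **Two-blob identity, saturated regime.**  If `ρ·EN ≤ m₀` then the lower-tail event is null: on the good
set `N ≥ m₀`. [folklore] -/
theorem lowerTail_twoBlobs_eq_zero {b : ℕ} (w : Sym2 (Fin n) → unitInterval) (A : Finset (Fin n))
    (o : Fin n) (cls : Fin n → Fin b)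
    (hcls : ∀ u ∈ insert o A, ∀ v ∈ insert o A, cls u = cls v →
      (prodBernoulli w).real (openConn u v)ᶜ = 0)
    (ρ : ℝ)
    (hthr : ρ * ∑ a ∈ A, (prodBernoulli w).real (openConn o a) ≤
      ((A.filter fun a => cls a = cls o).card : ℝ)) :
    (prodBernoulli w).real {ω : BondConfig (Fin n) |
        1 ≤ (A.filter fun a => ω ∈ openConn o a).card ∧
        ((A.filter fun a => ω ∈ openConn o a).card : ℝ) <
          ρ * ∑ a ∈ A, (prodBernoulli w).real (openConn o a)} = 0 := by
  classical
  set μ := prodBernoulli w with hμ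
  set G := {ω : BondConfig (Fin n) | ∀ u ∈ insert o A, ∀ v ∈ insert o A,
      cls u = cls v → (openGraph ω).Reachable u v} with hG
  have hG0 : μ.real Gᶜ = 0 := blobs_goodSet_compl_null w A o cls hcls
  rw [← measureReal_empty (μ := μ)]
  refine measureReal_eq_of_inter_eq μ hG0 (Set.ext fun ω => ?_)
  simp only [Set.mem_inter_iff, Set.mem_setOf_eq, Set.mem_empty_iff_false, false_and, iff_false,
    not_and]
  rintro ⟨-, hlt⟩ hωG
  have hge := blobs_count_ge_self A o cls ω hωG
  have hge' : ((A.filter fun a => cls a = cls o).card : ℝ) ≤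
      ((A.filter fun a => ω ∈ openConn o a).card : ℝ) := by exact_mod_cast hge
  linarith

/-- **The one-cut bound on two-blob templates is sharp.**  For every ratio `ρ ≤ 1`:
`μ{1 ≤ N ∧ N < ρ·EN} = 1{m₀ < ρ·EN} · μ(x ↮ y)`, where `μ(x ↮ y)` is the worst pairwise cut
(`twoBlobs_pairCut_le`).  In particular the one-cut bound holds with constant `1` and is attained whenever
`m₀ < ρ·EN` (e.g. `ρ = 1/2`, `m₀ = 1`, three far relays behind a cut of reliability `> 1/3`). [folklore] -/
theorem oneCut_twoBlobs_sharp (w : Sym2 (Fin n) → unitInterval) (A : Finset (Fin n)) (o : Fin n)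
    (cls : Fin n → Fin 2)
    (hcls : ∀ u ∈ insert o A, ∀ v ∈ insert o A, cls u = cls v →
      (prodBernoulli w).real (openConn u v)ᶜ = 0)
    {x y : Fin n} (hx : x ∈ A) (hcx : cls x = cls o) (hy : y ∈ A) (hcy : cls y ≠ cls o)
    (ρ : ℝ) (hρ1 : ρ ≤ 1) :
    (prodBernoulli w).real {ω : BondConfig (Fin n) |
        1 ≤ (A.filter fun a => ω ∈ openConn o a).card ∧
        ((A.filter fun a => ω ∈ openConn o a).card : ℝ) <
          ρ * ∑ a ∈ A, (prodBernoulli w).real (openConn o a)} =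
      if ((A.filter fun a => cls a = cls o).card : ℝ) <
          ρ * ∑ a ∈ A, (prodBernoulli w).real (openConn o a)
      then (prodBernoulli w).real (openConn x y)ᶜ else 0 := by
  split_ifs with hthr
  · exact lowerTail_twoBlobs_eq_cut w A o cls hcls hx hcx hy hcy ρ hρ1 hthr
  · exact lowerTail_twoBlobs_eq_zero w A o cls hcls ρ (not_lt.1 hthr)

end OneCutSymm

end Summit.CriticalPhenomena.PercolationContinuityZ3.Theorems

end
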